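import Literature.AlgebraicGeometry.Morphisms.CechModuleRestrictOpen
import Literature.AlgebraicGeometry.Modules.PullbackPushforwardTraceRetraction
import Literature.AlgebraicGeometry.Modules.PushforwardUnitHasRankOfFinrank
import HarnessLib

/-!
# `Ȟ¹` vanishing descends along a finite locally free morphism of invertible degree
# (trace retraction; The Stacks Project, Tag 0BVH; Hartshorne III Ex. 4.1)

Layer `Literature/AlgebraicGeometry/Morphisms`, namespace `Literature.AlgebraicGeometry.Morphisms` (the `CechMH1` currency of
`Morphisms/CechModule`).  THEOREMS ONLY (no definition, no named fact, no instance, no `sorry`).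

Let `g : Y → Spec A`, `f : X → Y` a morphism, `M` an `𝒪_Y`-module and `𝒰 = (U_i)` ANY family of opens of `Y`.

* (`Ȟ¹(𝒰, M) = 0 ↔ Ž¹ ⊆ B̌¹` is ★ `subsingleton_cechMH1_iff_cechMZ1_le_cechMB1` of `Morphisms/CechModuleRestrictOpen`.)
* §2 **`subsingleton_cechMH1_pushforward_of_subsingleton`** / `…_iff` — for ANY `f` and any `𝒪_X`-module `N`:
  `Ȟ¹(f⁻¹𝒰, N) = 0 ↔ Ȟ¹(𝒰, f_*N) = 0`.  The two ordered Čech complexes have literally the same cochains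
  (`Γ(f_*N, V) = Γ(N, f⁻¹V)`, `f⁻¹(U_i ∩ U_j) = f⁻¹U_i ∩ f⁻¹U_j`) and the same differentials ([Hartshorne1977] III Ex. 4.1 for an
  affine `f`; in degree `≤ 1` no affineness is needed for this identification of COMPLEXES).
* §3 **`subsingleton_cechMH1_of_retract_nsmul`** — if `η : M → N`, `ρ : N → M` with `η ≫ ρ = n · 𝟙_M` and `n` is invertible in `A`,
  then `Ȟ¹(𝒰, N) = 0 ⇒ Ȟ¹(𝒰, M) = 0` (functoriality of `Ȟ¹`, ★ `cechMapH1_comp`).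
* §4 **`subsingleton_cechMH1_of_subsingleton_cechMH1_pullback`** (HEAD) — for `f` AFFINE with `f_*𝒪_X` finite locally free of
  constant rank `n` INVERTIBLE in `A`, and `M` affine-localizing (e.g. quasi-coherent):
  **`Ȟ¹(f⁻¹𝒰, f^*M) = 0 ⇒ Ȟ¹(𝒰, M) = 0`** — apply §3 to the unit `η_M : M → f_*f^*M` and the ★ TRACE RETRACTION
  `ρ_M : f_*f^*M → M` of `Modules/PullbackPushforwardTraceRetraction` (`η_M ≫ ρ_M = n · 𝟙_M`, [StacksProject] Tag 0BVH «the composition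
  `𝒪_Y → π_*𝒪_X → 𝒪_Y` equals multiplication by the degree», tensored with `M`), then §2;
  `subsingleton_cechMH1_of_subsingleton_cechMH1_pullback_of_finrank_eq` — the same for `f` FINITE and FLAT over a locally Noetherian `Y`
  with `rk_y f = n` for all `y` (★ `hasRank_pushforward_unit_of_finrank_eq`) —
  the form consumed with `f = [n]_A` on an abelian variety (`rk = n^{2g}`, ★ `finrank_pow_id_left`).

Char-free (only «degree invertible in `A`»), no hypothesis on the family `𝒰`, no separatedness.  Cell `hodgecm-mathlib` (D-0151), F-DAG
leaf F-2 (b) FIELD CASE, road of record «`[n]`-trick» (B-plan1 (g16) 2026-08-30T07:21:48Z), file V1 of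
`B-provers/B-p05/g17/CENSUS-F2b-FieldVanishing.B-p05g17.md`; consumer V3 `AbelianVarieties/SymmetricAmpleH1Vanishing`
(`H¹(A, 𝒪(Θ)) = 0` for `Θ` symmetric ample).  Generic, count-neutral; HC_CM is proved only modulo the 7 printed citations until rung 0
closes — nothing here refers to it.

## References
* [StacksProject] The Stacks Project, Tag 0BVH (the trace of a finite locally free morphism; `Trace_π ∘ π♯ = deg π`), Tag 01ED (the Čech
  complex of a sheaf of modules is functorial), Tag 02KE (Čech complexes and direct images).
* [Hartshorne1977] R. Hartshorne, *Algebraic Geometry*, GTM 52 (1977), III Ex. 4.1 (cohomology along an affine morphism), III Ex. 8.2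
  (`𝓕 → f_*f^*𝓕` for finite flat `f`), IV Ex. 2.6 (trace of a finite flat morphism).
-/

noncomputable section

universe u v

open CategoryTheory AlgebraicGeometry TopologicalSpace Opposite
open AlgebraicGeometry.Scheme.Modules

namespace Literature.AlgebraicGeometry.Morphisms

open Literature.AlgebraicGeometry.Modules Literature.AlgebraicGeometry.Motives

variable {A : Type u} [CommRing A] {X Y : Scheme.{u}} (g : Y ⟶ Spec (.of A)) (f : X ⟶ Y)

/-! ## §2 `Ȟ¹(𝒰, f_*N)` is `Ȟ¹(f⁻¹𝒰, N)` -/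

section Pushforward

variable (N : X.Modules) {ι : Type v} (U : ι → Y.Opens)

/-- The `1`-cocycles of `f_*N` on `𝒰` are coboundaries as soon as those of `N` on `f⁻¹𝒰` are: the two ordered Čech complexes in
degrees `≤ 2` have the same cochains `Γ(f_*N, U_{i…}) = Γ(N, f⁻¹U_{i…})` and the same differentials.
[cite: Hartshorne1977, III Ex. 4.1] [cite: StacksProject, Tag 02KE] -/
theorem cechMZ1_pushforward_le_cechMB1_of_le
    (h : cechMZ1 (f ≫ g) N (fun i => f ⁻¹ᵁ U i) ≤ cechMB1 (f ≫ g) N (fun i => f ⁻¹ᵁ U i)) :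
    cechMZ1 g ((pushforward f).obj N) U ≤ cechMB1 g ((pushforward f).obj N) U := by
  intro c hc
  rw [mem_cechMZ1_iff] at hc
  -- the same cochain, read in the Čech complex of `N` on `f⁻¹𝒰` (definitionally equal cochain groups and differentials)
  let c' : CechMC1 (f ≫ g) N (fun i => f ⁻¹ᵁ U i) := fun i j => c i j
  have hc' : c' ∈ cechMZ1 (f ≫ g) N (fun i => f ⁻¹ᵁ U i) := by
    rw [mem_cechMZ1_iff]
    exact hc
  obtain ⟨b, hb⟩ := (mem_cechMB1_iff (f ≫ g) N (fun i => f ⁻¹ᵁ U i) c').1 (h hc')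
  rw [mem_cechMB1_iff]
  exact ⟨fun i => b i, hb⟩

/-- Conversely, the `1`-cocycles of `N` on `f⁻¹𝒰` are coboundaries as soon as those of `f_*N` on `𝒰` are.
[cite: Hartshorne1977, III Ex. 4.1] [cite: StacksProject, Tag 02KE] -/
theorem cechMZ1_le_cechMB1_of_pushforward_le
    (h : cechMZ1 g ((pushforward f).obj N) U ≤ cechMB1 g ((pushforward f).obj N) U) :
    cechMZ1 (f ≫ g) N (fun i => f ⁻¹ᵁ U i) ≤ cechMB1 (f ≫ g) N (fun i => f ⁻¹ᵁ U i) := by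
  intro c hc
  rw [mem_cechMZ1_iff] at hc
  let c' : CechMC1 g ((pushforward f).obj N) U := fun i j => c i j
  have hc' : c' ∈ cechMZ1 g ((pushforward f).obj N) U := by
    rw [mem_cechMZ1_iff]
    exact hc
  obtain ⟨b, hb⟩ := (mem_cechMB1_iff g ((pushforward f).obj N) U c').1 (h hc')
  rw [mem_cechMB1_iff]
  exact ⟨fun i => b i, hb⟩

/-- **`Ȟ¹(f⁻¹𝒰, N) = 0 ⇒ Ȟ¹(𝒰, f_*N) = 0`** for any morphism `f` and any `𝒪_X`-module `N`.
[cite: Hartshorne1977, III Ex. 4.1] [cite: StacksProject, Tag 02KE] -/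
theorem subsingleton_cechMH1_pushforward_of_subsingleton
    [h : Subsingleton (CechMH1 (f ≫ g) N (fun i => f ⁻¹ᵁ U i))] :
    Subsingleton (CechMH1 g ((pushforward f).obj N) U) :=
  (subsingleton_cechMH1_iff_cechMZ1_le_cechMB1 g U _).2
    (cechMZ1_pushforward_le_cechMB1_of_le g f N U ((subsingleton_cechMH1_iff_cechMZ1_le_cechMB1 (f ≫ g) _ N).1 h))

/-- **`Ȟ¹(𝒰, f_*N) = 0 ↔ Ȟ¹(f⁻¹𝒰, N) = 0`** for any morphism `f` and any `𝒪_X`-module `N`.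
[cite: Hartshorne1977, III Ex. 4.1] [cite: StacksProject, Tag 02KE] -/
theorem subsingleton_cechMH1_pushforward_iff :
    Subsingleton (CechMH1 g ((pushforward f).obj N) U) ↔ Subsingleton (CechMH1 (f ≫ g) N (fun i => f ⁻¹ᵁ U i)) := by
  rw [subsingleton_cechMH1_iff_cechMZ1_le_cechMB1 g U, subsingleton_cechMH1_iff_cechMZ1_le_cechMB1 (f ≫ g) (fun i => f ⁻¹ᵁ U i)]
  exact ⟨cechMZ1_le_cechMB1_of_pushforward_le g f N U, cechMZ1_pushforward_le_cechMB1_of_le g f N U⟩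

end Pushforward

/-! ## §3 Retracts up to an invertible integer -/

section Retract

variable {M N : Y.Modules} {ι : Type v} (U : ι → Y.Opens)

/-- Sections of an `ℕ`-multiple of a morphism of `𝒪`-modules: `(n • φ)_V(x) = n • φ_V(x)`. [folklore] -/
private theorem nsmul_app_apply (φ : M ⟶ N) (n : ℕ) (V : Y.Opens) (x : Γ(M, V)) :
    (n • φ).app V x = n • φ.app V x := by
  induction n with
  | zero =>
    rw [zero_nsmul, zero_nsmul, Scheme.Modules.Hom.zero_app]
    rfl
  | succ n ih =>
    rw [succ_nsmul, succ_nsmul, Scheme.Modules.Hom.add_app, ← ih]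
    rfl

/-- `Ȟ¹(𝒰, n • 𝟙_M)` is multiplication by `n`. [cite: StacksProject, Tag 01ED] -/
theorem cechMapH1_nsmul_id (M : Y.Modules) (n : ℕ) (x : CechMH1 g M U) :
    cechMapH1 g (n • 𝟙 M) U x = n • x := by
  obtain ⟨z, rfl⟩ := CechMH1.mk_surjective g M U x
  rw [cechMapH1_mk, ← map_nsmul]
  congr 1
  apply Subtype.ext
  rw [cechMapZ1_coe]
  funext i j
  rw [cechMapC1_apply, MSections.app_apply, nsmul_app_apply, Scheme.Modules.Hom.id_app]
  rfl

/-- **A retract up to an invertible integer has vanishing `Ȟ¹` if the big module has**: if `η : M → N`, `ρ : N → M` satisfy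
`η ≫ ρ = n • 𝟙_M` with `n` invertible in `A`, then `Ȟ¹(𝒰, N) = 0 ⇒ Ȟ¹(𝒰, M) = 0` (`x = n⁻¹ · Ȟ¹(ρ)(Ȟ¹(η)(x))`).
[cite: StacksProject, Tag 0BVH] [cite: StacksProject, Tag 01ED] -/
theorem subsingleton_cechMH1_of_retract_nsmul (η : M ⟶ N) (ρ : N ⟶ M) (n : ℕ) (hηρ : η ≫ ρ = n • 𝟙 M)
    (hn : IsUnit (n : A)) [Subsingleton (CechMH1 g N U)] : Subsingleton (CechMH1 g M U) := by
  refine subsingleton_of_forall_eq 0 fun x => ?_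
  obtain ⟨u, hu⟩ := hn
  have h1 : n • x = 0 := by
    rw [← cechMapH1_nsmul_id g U M n x, ← hηρ, cechMapH1_comp, Subsingleton.elim (cechMapH1 g η U x) 0, map_zero]
  have h2 : (n : A) • x = 0 := by rw [Nat.cast_smul_eq_nsmul]; exact h1
  calc x = ((↑u⁻¹ : A) * (n : A)) • x := by rw [← hu, Units.inv_mul, one_smul]
    _ = 0 := by rw [mul_smul, h2, smul_zero]

end Retract

/-! ## §4 The head: `Ȟ¹` vanishing descends along `f` finite locally free of invertible degree -/

section Head

variable {ι : Type v} (U : ι → Y.Opens)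

/-- **`Ȟ¹(f⁻¹𝒰, f^*M) = 0 ⇒ Ȟ¹(𝒰, M) = 0` along an affine `f` with `f_*𝒪_X` finite locally free of constant rank `n` invertible in
`A`**, for `M` affine-localizing (e.g. quasi-coherent) and any family of opens `𝒰`: the unit `η_M : M → f_*f^*M` and the trace retraction
`ρ_M : f_*f^*M → M` satisfy `η_M ≫ ρ_M = n • 𝟙_M` (★ `pullbackUnit_comp_traceRetraction`), so §3 applies to `N = f_*f^*M`, whose `Ȟ¹` on `𝒰`
is `Ȟ¹(f⁻¹𝒰, f^*M)` (§2). [cite: StacksProject, Tag 0BVH] [cite: Hartshorne1977, III Ex. 4.1 and III Ex. 8.2] -/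
theorem subsingleton_cechMH1_of_subsingleton_cechMH1_pullback [IsAffineHom f] (n : ℕ)
    (hrk : HasRank ((pushforward f).obj (unitModule X)) n) (hn : IsUnit (n : A))
    (M : Y.Modules) (hM : IsAffineLocalizing M)
    [Subsingleton (CechMH1 (f ≫ g) ((pullback f).obj M) (fun i => f ⁻¹ᵁ U i))] :
    Subsingleton (CechMH1 g M U) := by
  haveI : Subsingleton (CechMH1 g ((pushforward f).obj ((pullback f).obj M)) U) :=
    subsingleton_cechMH1_pushforward_of_subsingleton g f ((pullback f).obj M) U
  obtain ⟨F, hF⟩ := exists_frameSystem_of_hasRank hrk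
  have h : IsFiniteLocallyFree ((pushforward f).obj (unitModule X)) := F.isFiniteLocallyFree
  have hηρ : pullbackUnit f M ≫ traceRetraction f h M hM = n • 𝟙 M :=
    pullbackUnit_comp_traceRetraction f h M hM n fun y =>
      ⟨F.U y, F.mem y, F.I y, Fintype.ofEquiv _ (F.enum y).symm, F.frame y, by
        rw [Fintype.ofEquiv_card, Fintype.card_fin, hF]⟩
  exact subsingleton_cechMH1_of_retract_nsmul g U (pullbackUnit f M) (traceRetraction f h M hM) n hηρ hn

/-- **The same for `f` FINITE and FLAT of constant rank `n` over a locally Noetherian `Y`** (`rk_y f = n` for all `y`, Mathlib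
`Scheme.Hom.finrank`; `n` invertible in `A`): `Ȟ¹(f⁻¹𝒰, f^*M) = 0 ⇒ Ȟ¹(𝒰, M) = 0` — e.g. `f = [n]_A` on an abelian variety over a field
of characteristic prime to `n` (degree `n^{2g}`). [cite: StacksProject, Tag 0BVH] [cite: Hartshorne1977, III Ex. 4.1 and IV Ex. 2.6] -/
theorem subsingleton_cechMH1_of_subsingleton_cechMH1_pullback_of_finrank_eq [IsFinite f] [Flat f] [IsLocallyNoetherian Y]
    (n : ℕ) (hfin : ∀ y : Y, f.finrank y = n) (hn : IsUnit (n : A)) (M : Y.Modules) (hM : IsAffineLocalizing M)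
    [Subsingleton (CechMH1 (f ≫ g) ((pullback f).obj M) (fun i => f ⁻¹ᵁ U i))] :
    Subsingleton (CechMH1 g M U) :=
  subsingleton_cechMH1_of_subsingleton_cechMH1_pullback g f U n (hasRank_pushforward_unit_of_finrank_eq f n hfin) hn M hM

end Head

end Literature.AlgebraicGeometry.Morphisms

end
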